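import Summits.BirchSwinnertonDyer.BirchSwinnertonDyer.Theorems.GenusKolyvaginAtTwoOffCutResidualAtTwoRSocleSelectionHeegnerSocleUnram
import HarnessLib

/-!
# Route `GenusKolyvaginAtTwo`, residual `OffCutResidualAtTwoR` (stmt-BirchSwinnertonDyer-31767), LINE 27 «socle_selection» STUB S2 —
# THE CAPITULATION KERNEL IS THE REAL-TRIVIAL LINE (element form, both directions) WITHOUT the clause «`2` split in `K`»

Width seat `bsd-line-gk2-p5` g38 (cell `bsd-f1-sign2`), `--supports stmt-BirchSwinnertonDyer-31767 --as helper`; sequel of LEAD `bsd-line-gk2-p1` g25's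
`…SocleSelectionHeegnerSocleSOC` §3b (`resTorsion_eq_kummer_of_realTrivial` / `realTrivial_of_resTorsion_eq_kummer`, which carry the binder
`h2K : #{𝔭 ∣ 2} = 2`) and `…SocleSelectionHeegnerSocleUnram` (the `h2K`-free (A1)/(A2): `realTrivial_iff_mem_primeTwist_selmerGroup_of_descAdmissible_or_unram`,
`natCard_realTrivial_eq_two'`, over this seat's inert-`2` dictionary `…PrimeTwistUnramifiedTwo`).  THEOREMS ONLY (no definition, no named fact, no `sorry`).
**BSD is NOT proved by this file; `OffCutResidualAtTwoR`, K4Pos and crux 25504 are NOT proved; S2 is closed only with gk2-p4's (HL).**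

WHY.  gk2-p4 g30's (HL) assembly for LINE 27 S2a consumes LEAD's two §3b theorems and gk2-p5's `existsUnique_resTorsion_eq_kummer_of_depth_pos`, hence
«will carry the SAME extra binder h2K» (STATUS 15:30:31Z).  With this file (§3b `h2K`-free) and `KFourPosCell.existsUnique_resTorsion_eq_kummer_of_depth_pos_of_oddDiscr`
(this seat, `…PosDiscShallowKFourPosCellTwoUnramified`), (HL) can be stated on `stub_heegnerLift`'s binders VERBATIM — `d_K` odd puts `2` split or inert.

* `resTorsion_eq_kummer_of_realTrivial_of_oddDiscr` — a non-zero REAL-TRIVIAL `2`-Selmer class restricts to `κ₂(Q₀)` for ANY `Q₀ ∈ E(K) ∖ 2E(K)`.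
* `realTrivial_of_resTorsion_eq_kummer_of_oddDiscr` — conversely the descent of `κ₂(Q₀)` is real-trivial and Selmer.
Proofs = LEAD's, with `realTrivial_iff_mem_primeTwist_selmerGroup` / `natCard_realTrivial_eq_two` replaced by their `h2K`-free forms.

Honest framing: Kramer 1981 / Gross 1991 §5 bookkeeping; KNOWN in print; kernel-new; beyond-print theorem: no.  BSD is NOT proved by any of this.

References: [Kramer1981] Thm. 1, Prop. 7; [GrossLMS1991] §5 (5.1); [MazurRubin2010] Lemma 2.10 (v), Def. 3.1, Lemma 3.2; [SilvermanAEC2009] VIII.§2, Thm. X.4.2.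
-/

set_option autoImplicit false
-- the Theorems namespace of this sub repeats the summit name by design (D-0017 nested layout)
set_option linter.dupNamespace false

noncomputable section

open scoped Classical

namespace Summit.BirchSwinnertonDyer.BirchSwinnertonDyer.Theorems.GenusExact.PlusDescent.SocleSelection

open WeierstrassCurve NumberField IsDedekindDomain Field
open Literature.NumberTheory.EllipticCurves Literature.NumberTheory.GaloisRepresentations
open Summit.BirchSwinnertonDyer.Rank1Residual.F1Sign2 (DescAdmissible DescAdmissibleUnram NoRationalTwoTorsion IsQuadraticCharacterOf)
open Summit.BirchSwinnertonDyer.BirchSwinnertonDyer.Theorems.GenusKolyArch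
open Summit.BirchSwinnertonDyer.BirchSwinnertonDyer.Theorems.GenusSupplyNarrow.KFourPosCell

/-- `E(K)[2] = 0` (in `(2 : ℤ) •` form) for `ρ̄_{E,2}` onto and `K` imaginary quadratic (LEAD's private lemma, restated). [cite: DokchitserDokchitserMathZ2012, Theorem (1)] -/
private theorem two_zsmul_eq_zero_imp' (W : WeierstrassCurve ℚ) [W.IsElliptic] {K : Type} [Field K] [NumberField K]
    (hρ : W.HasSurjectiveModNGaloisRep 2) (hK : IsImaginaryQuadratic K) (T : (W.baseChange K).toAffine.Point) (hT2 : (2 : ℤ) • T = 0) :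
    T = 0 := by
  have hmem : T ∈ AddSubgroup.torsionBy (W.baseChange K).toAffine.Point (2 : ℤ) := (Submodule.mem_torsionBy_iff _ T).mpr hT2
  rw [torsionBy_two_baseChange_eq_bot_of_hasSurjectiveModNGaloisRep_two_of_isImaginaryQuadratic W hρ K hK] at hmem
  exact AddSubgroup.mem_bot.mp hmem

section CapitulationKernel

variable (W : WeierstrassCurve ℚ) [W.IsElliptic] [W.IsGloballyMinimal] {K : Type} [Field K] [NumberField K]

/-- **A non-zero REAL-TRIVIAL `2`-Selmer class restricts to `κ₂(Q₀)`, no clause at `2`** — for ANY `Q₀ ∈ E(K) ∖ 2E(K)` on the shallow `Δ > 0` Heegner frame with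
odd `d_K` (`rank Wd(ℚ) = rank E(K) = 1`): LEAD's `resTorsion_eq_kummer_of_realTrivial` with the binder `h2K` deleted (the real-trivial line is the twin's Selmer
group by the `h2K`-free (A2), then LEAD's capitulation `resTorsion_mem_range_kummer_of_mem_primeTwist_selmerGroup`, the rank-one Kummer dichotomy and the
injectivity of `res_K`).  BSD is NOT proved by this. [cite: Kramer1981, Thm. 1] [cite: GrossLMS1991, §5 (5.1)] [cite: MazurRubin2010, Lemma 2.10 (v)] -/
theorem resTorsion_eq_kummer_of_realTrivial_of_oddDiscr [NeZero (W.conductorNorm ℤ)] (hΔ : 0 < W.Δ) (hρ : W.HasSurjectiveModNGaloisRep 2)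
    (hTam : Odd W.tamagawaProduct) (h4 : Nat.card (W.selmerGroup 2) = 4) (hK : IsImaginaryQuadratic K) (hodd : Odd (discr K))
    (hH : SatisfiesHeegnerHypothesis (W.conductorNorm ℤ) K)
    {Wd : WeierstrassCurve ℚ} [Wd.IsElliptic] (Cd : VariableChange ℚ) (hCd : Cd • W.quadraticTwist (discr K : ℚ) = Wd)
    (hDEF : padicValNat 2 Wd.tamagawaProduct = 0) (hSel : Nat.card (Wd.selmerGroup 2) = 2) (hrank : Wd.mordellWeilRank = 1)
    (hrkK : (W.baseChange K).mordellWeilRank = 1)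
    {Q₀ : (W.baseChange K).toAffine.Point} (hQ₀ : ¬ ∃ R : (W.baseChange K).toAffine.Point, (2 : ℤ) • R = Q₀)
    {s : galH1Torsion W ((2 : ℕ) : ℤ)} (hs : s ∈ W.selmerGroup ((2 : ℕ) : ℤ)) (hs0 : s ≠ 0)
    (hinf : ∀ w : InfinitePlace ℚ, s ∈ W.torsionLocalKer w.Completion ((2 : ℕ) : ℤ)) :
    resTorsion W K ((2 : ℕ) : ℤ) s = kummerMapTorsion (W.baseChange K) ((2 : ℕ) : ℤ) (hdiv_two_baseChange W K) Q₀ := by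
  haveI : (W.baseChange K).IsElliptic := inferInstanceAs (W.map (algebraMap ℚ K)).IsElliptic
  have h2 : Module.finrank ℚ K = 2 := hK.1
  obtain ⟨θ, hθ, hθc⟩ := exists_sq_eq_discr_not_mem_range K h2
  have hT : NoRationalTwoTorsion W := GenusKolyTwin.noRationalTwoTorsion_of_hasSurjectiveModNGaloisRep W (by simpa using hρ)
  obtain ⟨χ, hχ⟩ := GenusKolyTransp.quadraticCharacterExists_holds (discr K)
  have h2Kt := two_zsmul_eq_zero_imp' W hρ hK
  have hd := descAdmissible_or_unram_of_shallowTwin W hK hodd hH hTam Cd hCd hDEF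
  have hsT : s ∈ PrimeTwist.selmerGroup W χ :=
    (realTrivial_iff_mem_primeTwist_selmerGroup_of_descAdmissible_or_unram W hΔ hρ h4 hd Cd hCd hSel hχ s).mp ⟨hs, hinf⟩
  obtain ⟨Q', hQ'⟩ := resTorsion_mem_range_kummer_of_mem_primeTwist_selmerGroup W (K := K) hT (NumberField.discr_ne_zero K)
    ⟨θ, hθc⟩ Cd hCd hrank hSel hχ hsT
  have hresne : resTorsion W K ((2 : ℕ) : ℤ) s ≠ 0 := fun h0 ↦ hs0
    (GenusExact.EigenClassesFinite.resTorsion_injective_of_noTorsion W K h2 hθ hθc ((2 : ℕ) : ℤ) h2Kt (by rw [h0, map_zero]))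
  rcases kummerMapTorsion_eq_zero_or_eq_of_rank_one W K hrkK h2Kt hQ₀ Q' with h0 | h1
  · exact absurd (hQ'.symm.trans h0) hresne
  · rw [← hQ', h1]

/-- **Conversely, the descent of `κ₂(Q₀)` is a REAL-TRIVIAL `2`-Selmer class, no clause at `2`** (LEAD's `realTrivial_of_resTorsion_eq_kummer` with `h2K` deleted):
the real-trivial line has exactly two elements (`natCard_realTrivial_eq_two'`), its non-zero element restricts to `κ₂(Q₀)`, and `res_K` is injective.  So on the
shallow frame with odd `d_K`: CAPITULATION KERNEL = REAL-TRIVIAL LINE = TWIN'S SELMER GROUP.  BSD is NOT proved by this. [cite: Kramer1981, Thm. 1]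
[cite: GrossLMS1991, §5 (5.1)] -/
theorem realTrivial_of_resTorsion_eq_kummer_of_oddDiscr [NeZero (W.conductorNorm ℤ)] (hΔ : 0 < W.Δ) (hρ : W.HasSurjectiveModNGaloisRep 2)
    (hTam : Odd W.tamagawaProduct) (h4 : Nat.card (W.selmerGroup 2) = 4) (hK : IsImaginaryQuadratic K) (hodd : Odd (discr K))
    (hH : SatisfiesHeegnerHypothesis (W.conductorNorm ℤ) K)
    {Wd : WeierstrassCurve ℚ} [Wd.IsElliptic] (Cd : VariableChange ℚ) (hCd : Cd • W.quadraticTwist (discr K : ℚ) = Wd)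
    (hDEF : padicValNat 2 Wd.tamagawaProduct = 0) (hSel : Nat.card (Wd.selmerGroup 2) = 2) (hrank : Wd.mordellWeilRank = 1)
    (hrkK : (W.baseChange K).mordellWeilRank = 1)
    {Q₀ : (W.baseChange K).toAffine.Point} (hQ₀ : ¬ ∃ R : (W.baseChange K).toAffine.Point, (2 : ℤ) • R = Q₀)
    {s : galH1Torsion W ((2 : ℕ) : ℤ)}
    (hs : resTorsion W K ((2 : ℕ) : ℤ) s = kummerMapTorsion (W.baseChange K) ((2 : ℕ) : ℤ) (hdiv_two_baseChange W K) Q₀) :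
    s ∈ W.selmerGroup ((2 : ℕ) : ℤ) ∧ ∀ w : InfinitePlace ℚ, s ∈ W.torsionLocalKer w.Completion ((2 : ℕ) : ℤ) := by
  haveI : (W.baseChange K).IsElliptic := inferInstanceAs (W.map (algebraMap ℚ K)).IsElliptic
  have h2 : Module.finrank ℚ K = 2 := hK.1
  obtain ⟨θ, hθ, hθc⟩ := exists_sq_eq_discr_not_mem_range K h2
  have h2Kt := two_zsmul_eq_zero_imp' W hρ hK
  have hcard := natCard_realTrivial_eq_two' W hΔ hρ hTam h4 hK hodd hH Cd hCd hDEF hSel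
  have h0mem : (0 : galH1Torsion W ((2 : ℕ) : ℤ)) ∈ W.selmerGroup ((2 : ℕ) : ℤ) ∧
      ∀ w : InfinitePlace ℚ, (0 : galH1Torsion W ((2 : ℕ) : ℤ)) ∈ W.torsionLocalKer w.Completion ((2 : ℕ) : ℤ) :=
    ⟨AddSubgroup.zero_mem _, fun w ↦ AddSubgroup.zero_mem _⟩
  obtain ⟨t, ht, -⟩ := (Nat.card_eq_two_iff' (⟨0, h0mem⟩ : {s : galH1Torsion W ((2 : ℕ) : ℤ) //
      s ∈ W.selmerGroup ((2 : ℕ) : ℤ) ∧ ∀ w : InfinitePlace ℚ, s ∈ W.torsionLocalKer w.Completion ((2 : ℕ) : ℤ)})).mp hcard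
  have ht0 : (t : galH1Torsion W ((2 : ℕ) : ℤ)) ≠ 0 := fun h ↦ ht (Subtype.ext h)
  have hrest := resTorsion_eq_kummer_of_realTrivial_of_oddDiscr W hΔ hρ hTam h4 hK hodd hH Cd hCd hDEF hSel hrank hrkK hQ₀ t.2.1 ht0 t.2.2
  have hst : s = t :=
    GenusExact.EigenClassesFinite.resTorsion_injective_of_noTorsion W K h2 hθ hθc ((2 : ℕ) : ℤ) h2Kt (by rw [hs, hrest])
  rw [hst]
  exact t.2

end CapitulationKernel

end Summit.BirchSwinnertonDyer.BirchSwinnertonDyer.Theorems.GenusExact.PlusDescent.SocleSelection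

end
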